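/-
Origin: expansion seat `prover-pub-hodgecm-mc-binder-2-g12-0`, handover #59 2026-08-20T06:18Z md5 a8c77ef8f652 (123 l.; CERTIFIED same mirror: rc 0 / 0 err / 0 warn / 38 s; `#print axioms` of archSK_eq_closure_span · follandFock_mem_archSK ⊆ trio (`g12/certs/axioms-58-59.log`); imports #57 `DenseTensor` (RUN 42), #58 `DenseArch`, #51 `InsMemKInf` (RUN 41); (J-dense) STEP (iii) AT THE W PIN OF RECORD (`K_∞ = KInfty V`, frame ι₁/sylvesterFrame): abbrev `etaK k := η(archProdHom (archPairOf k))`, `archKOp_apply_eq_letters` (`archKOp k f = etaK k • ω_∞(letterSection (kVLetters (lett k))) f`, #50 `letterSection_lett`), **`pinIsotypicPolys := isotypicFockPolys (letterBlockOf ∘ kVLetters ∘ lett) (etaK · pinLetterChar ∘ kVLetters ∘ lett) archKappa`** (THE HOMOGENEOUS K_∞-ISOTYPIC POLYNOMIALS OF THE PIN on `Fin 6 × places`), `mem_pinIsotypicPolys` (Iff.rfl), **`archSK_eq_closure_span : (archSK V S hGR η ι₁ V.sylvesterFrame _ : Set 𝓢) = closure (span (follandFock cmBigFrame '' pinIsotypicPolys))`**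 under the sign fact `hW` at ι₁ only (V's sign facts are `frameD_sign_ι₁'`/`frameD_sign_of_ne`, W's off-ι₁ from `signs_fin_two` — exactly `pinLetterChar`'s inputs), `mem_closure_span_follandFock_of_mem_archSK`, `follandFock_mem_archSK`; WITH #57: `W₀.SK = span{E(Φ_∞ ⊗ f) : Φ_∞ ∈ closure span (follandFock '' pinIsotypicPolys)}` — so the census field `dense` is REDUCED to (iv) the algebraic identification `pinIsotypicPolys ⊆ span of products of printed place polynomials` (per place: #20 Σ, #21 D, ι₁ `FockRowDeterminantIsotypic`, `PolynomialPlaceIsotypic`; needs the values of `etaK · pinLetterChar` on K_∞, cf. (V-val) `hκ`) and (v) (J-top) #7 Θ-continuity of `Φ_∞ ↦ toTop E(Φ_∞ ⊗ f)`; 0 Prop-defs / 0 records / 0 proof-hole-class tokens; FQN scan: 0 collisions; NAME LIST `HodgeCM.Model.HypCensus.archSK_eq_closure_span` · `HodgeCM.Model.HypCensus.pinIsotypicPolys` · `HodgeCM.Model.HypCensus.archKOp_apply_eq_letters`) (`HOME/mc/pub-hodgecm-mc-binder-2/g12/pkg/HodgeCM/Model/HypCensus/DensePin.lean`, md5 a8c77ef8f652,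 123 lines);
landed by the gen-16 packager (p-g16) in gate run 43 as `HodgeCM/Model/HypCensus/DensePin.lean` (verbatim).
-/
/-
Copyright (c) 2026. All rights reserved.
Released under Apache 2.0 license as described in the file LICENSE.
-/
import Summits.HodgeConjecture.HodgeCM.Model.HypCensus.DenseTensor
import Summits.HodgeConjecture.HodgeCM.Model.HypCensus.DenseArch
import Summits.HodgeConjecture.HodgeCM.Model.HypCensus.InsMemKInf

/-!
# (J-dense), step (iii) at the W pin of record: `𝒮_∞^κ` is the closure of the span of isotypic Folland–Fock vectors

Binder-2 lineage, rows 18/19 (`hyp12`/`hyp34`), field `dense` of `HypCoreW`.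

At the W pin of record `W₀ = wmInputCM₂g V S hGR η hη hηc ι₁ V.sylvesterFrame _` (so `K_∞ = KInfty V`):
* `archKOp_apply_eq_letters`: for `k ∈ K_∞`, `archKOp k f = η((g⁻¹kg)_𝔸, 1) • ω_∞(letterSection (kVLetters (lett k))) f`
  (#50 `letterSection_lett`);
* **`archSK_eq_closure_span`**: under the sign fact `hW` at `ι₁`, the archimedean `κ`-isotypic subspace `archSK` (#57) IS
  the Schwartz-closure of the span of the Folland–Fock vectors `follandFock cmBigFrame G`, `G` running through the
  HOMOGENEOUS polynomials on `Fin 6 × places` with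
  `(η((g⁻¹kg)_𝔸,1) · pinLetterChar (kVLetters (lett k))) • (G ∘ letters(k)⁻¹) = κ(k) • G` for all `k ∈ K_∞` —
  `pinIsotypicPolys`.
With #57 `SK_wmInputCM₂g_eq_span` this leaves for `dense` only: (iv) the algebraic identification of `pinIsotypicPolys` with
the span of the products of printed place polynomials, and (v) the Θ-continuity of `Φ_∞ ↦ toTop E(Φ_∞ ⊗ f)` ((J-top) #7).
[cite: Folland1989, Prop (4.39), Ch. 4 §5]
-/

noncomputable section

open NumberField NumberField.InfinitePlace IsDedekindDomain
open scoped Matrix Classical TensorProduct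
open MvPolynomial
open Literature.NumberTheory.Automorphic Literature.NumberTheory.Automorphic.UnitaryGroup Literature.NumberTheory.Weil1964
open Literature.RepresentationTheory.KonnoKonno2007 Literature.RepresentationTheory.KonnoKonno2007.RealDualPair
open Literature.NumberTheory.GelbartRogawski1991 Literature.NumberTheory.GelbartRogawski1991.UnitaryDualPair
open Literature.Analysis.SegalBargmann
open HodgeCM HodgeCM.Model

namespace HodgeCM.Model.HypCensus

section Pin

variable {L : CMField} {ι₁ : L →+* ℂ} (V : HermSpace3 L ι₁) (S : StubTree.SeesawDatum L)
variable
  (hGR : (cmSplittingDatum (L : Type) finProdFinEquiv (frameD V) (frameD_real V) (frameD_ne V) (dW S) (dW_real S) (dW_ne S)).CompatibleSplitting)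
  (η : CMAdelic (L : Type) (frameD V) × CMAdelic (L : Type) (dW S) →* ℂˣ)
  (hW : (∀ j, 0 < (ι₁ (dW S j)).re) ∨ ∀ j, (ι₁ (dW S j)).re < 0)

/-- The `η`-scalar of `k ∈ K_∞` at the W pin: `η((g⁻¹kg)_𝔸, 1)`. -/
abbrev etaK (k : ↥(KInfty V)) : ℂ :=
  ((η (archProdHom (↥(maximalRealSubfield L)) (L : Type) (IsCMField.complexConj L) 3 2 (Matrix.diagonal (frameD V))
      (Matrix.diagonal (dW S)) (archPairOf V S ι₁ V.sylvesterFrame (sylvesterFrame_formCongr V) k)) : ℂˣ) : ℂ)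

/-- `archKOp k = η((g⁻¹kg)_𝔸,1) • ω_∞(letterSection (kVLetters (lett k)))` on every Schwartz function (#50 `letterSection_lett`). -/
theorem archKOp_apply_eq_letters (k : ↥(KInfty V))
    (f : SchwartzMap (Fin 6 → mixedEmbedding.mixedSpace (↥(maximalRealSubfield L))) ℂ) :
    archKOp V S hGR η ι₁ V.sylvesterFrame (sylvesterFrame_formCongr V) k f =
      etaK V S η k •
        cmArchWeilRep (L : Type) finProdFinEquiv (frameD V) (frameD_real V) (frameD_ne V) (dW S) (dW_real S) (dW_ne S) hGR
          (letterSection (L : Type) (frameD V) (frameD_real V) (frameD_ne V) (dW S) (dW_real S) (dW_ne S) ι₁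
            (kVLetters V S (lett V S k))) f := by
  rw [letterSection_lett]
  rfl

/-- **The isotypic homogeneous polynomials of the W pin**: homogeneous `G` on `Fin 6 × places` with
`(η((g⁻¹kg)_𝔸,1) · pinLetterChar (kVLetters (lett k))) • (G ∘ letters(k)⁻¹) = κ(k) • G` for every `k ∈ K_∞`. -/
def pinIsotypicPolys : Set (MvPolynomial (Fin 6 × {v : InfinitePlace ↥(maximalRealSubfield L) // v.IsReal}) ℂ) :=
  isotypicFockPolys
    (fun k : ↥(KInfty V) => letterBlockOf (L : Type) (frameD V) (frameD_real V) (dW S) (dW_real S) ι₁ (kVLetters V S (lett V S k)))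
    (fun k => etaK V S η k * ((pinLetterChar V S hGR hW (kVLetters V S (lett V S k)) : Circle) : ℂ))
    fun k => ((UnitaryGroup.archKappa (L : Type) V.Hm ι₁ V.sylvesterFrame (sylvesterFrame_formCongr V) k : ℂˣ) : ℂ)

/-- Membership in `pinIsotypicPolys`. -/
theorem mem_pinIsotypicPolys {G : MvPolynomial (Fin 6 × {v : InfinitePlace ↥(maximalRealSubfield L) // v.IsReal}) ℂ} :
    G ∈ pinIsotypicPolys V S hGR η hW ↔
      (∃ d, G.IsHomogeneous d) ∧ ∀ k : ↥(KInfty V),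
        (etaK V S η k * ((pinLetterChar V S hGR hW (kVLetters V S (lett V S k)) : Circle) : ℂ)) •
            linSubst (star ((letterBlockOf (L : Type) (frameD V) (frameD_real V) (dW S) (dW_real S) ι₁
              (kVLetters V S (lett V S k)) : Matrix.unitaryGroup _ ℂ) : Matrix _ _ ℂ)) G =
          ((UnitaryGroup.archKappa (L : Type) V.Hm ι₁ V.sylvesterFrame (sylvesterFrame_formCongr V) k : ℂˣ) : ℂ) • G :=
  Iff.rfl

include hW in
/-- **(J-dense) step (iii) at the W pin of record: `𝒮_∞^κ = closure (span (follandFock 𝔢 '' pinIsotypicPolys))`.**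
[cite: Folland1989, Ch. 4 §5] -/
theorem archSK_eq_closure_span :
    (archSK V S hGR η ι₁ V.sylvesterFrame (sylvesterFrame_formCongr V) :
        Set (SchwartzMap (Fin 6 → mixedEmbedding.mixedSpace (↥(maximalRealSubfield L))) ℂ)) =
      closure (Submodule.span ℂ
        ((fun G => follandFock (cmBigFrame (L : Type) finProdFinEquiv (frameD V) (frameD_real V) (frameD_ne V) (dW S)
            (dW_real S) (dW_ne S) ι₁) G) '' pinIsotypicPolys V S hGR η hW) :
          Set (SchwartzMap (Fin 6 → mixedEmbedding.mixedSpace (↥(maximalRealSubfield L))) ℂ)) := by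
  rw [pinIsotypicPolys, ← setOf_eigen_letters_eq_closure_span (L : Type) (frameD V) (frameD_real V) (frameD_ne V) (dW S)
    (dW_real S) (dW_ne S) hGR ι₁ (frameD_sign_ι₁' V) hW (frameD_sign_of_ne V)
    (fun τ' _ => signs_fin_two fun j => re_apply_ne_zero_of_complexConj_eq (L : Type) τ' (dW_real S j) (dW_ne S j))]
  ext f
  simp only [SetLike.mem_coe, mem_archSK, Set.mem_setOf_eq, archKOp_apply_eq_letters]

include hW in
/-- Membership form: every `Φ_∞ ∈ 𝒮_∞^κ` is a Schwartz-limit of combinations of isotypic Folland–Fock vectors. -/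
theorem mem_closure_span_follandFock_of_mem_archSK
    {f : SchwartzMap (Fin 6 → mixedEmbedding.mixedSpace (↥(maximalRealSubfield L))) ℂ}
    (hf : f ∈ archSK V S hGR η ι₁ V.sylvesterFrame (sylvesterFrame_formCongr V)) :
    f ∈ closure (Submodule.span ℂ
        ((fun G => follandFock (cmBigFrame (L : Type) finProdFinEquiv (frameD V) (frameD_real V) (frameD_ne V) (dW S)
            (dW_real S) (dW_ne S) ι₁) G) '' pinIsotypicPolys V S hGR η hW) :
          Set (SchwartzMap (Fin 6 → mixedEmbedding.mixedSpace (↥(maximalRealSubfield L))) ℂ)) := by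
  rw [← archSK_eq_closure_span V S hGR η hW]
  exact hf

include hW in
/-- Converse: every isotypic Folland–Fock vector lies in `𝒮_∞^κ`. -/
theorem follandFock_mem_archSK {G : MvPolynomial (Fin 6 × {v : InfinitePlace ↥(maximalRealSubfield L) // v.IsReal}) ℂ}
    (hG : G ∈ pinIsotypicPolys V S hGR η hW) :
    follandFock (cmBigFrame (L : Type) finProdFinEquiv (frameD V) (frameD_real V) (frameD_ne V) (dW S) (dW_real S) (dW_ne S) ι₁) G ∈
      archSK V S hGR η ι₁ V.sylvesterFrame (sylvesterFrame_formCongr V) := by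
  rw [← SetLike.mem_coe, archSK_eq_closure_span V S hGR η hW]
  exact subset_closure (Submodule.subset_span ⟨G, hG, rfl⟩)

end Pin

end HodgeCM.Model.HypCensus

end
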